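import Literature.NumberTheory.Rogawski1990.ArchDeltaTransferCentralVanishing          -- ★ (S-c) `archDeltaTransfer_apply_center_eq_zero` and its whole import cone ((β), (3A′), frames, congruences)
import Literature.NumberTheory.Rogawski1990.ArchEndoscopicTorusTransferIdentityPre       -- ★ (β₀) `exists_sum_integral_pi_eq_inv_mul_finsum_delta` (ONE κ, every regular torus datum)
import Literature.NumberTheory.Rogawski1990.ArchDeltaClassSumCongruence                  -- ★ (α) `finsum_delta_mul_integral_comp_conj_eq_comap`
import Literature.NumberTheory.Automorphic.ArchEndoscopicCentralDescentValue              -- ★ V1 p854794 `sum_integral_pi_empty_eq_card_smul_apply_center`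
import Literature.NumberTheory.Rogawski1990.ArchSplitRationalWallTorusPoint              -- ★ (m2) `exists_isStablyConj_cmRationalToArch_archDiagTorus_wall`
import Literature.NumberTheory.Rogawski1990.ArchSingularStableClassFrames                -- ★ `exists_isSingularArchFrame_of_isStablyConj_cmRationalToArch` (all classes framed)
import Literature.NumberTheory.Rogawski1990.TamagawaSingularKappaBlockTransport          -- ★ `not_isRegularElt_of_charpoly_eq_sq_mul`
import Literature.NumberTheory.Weil1964.UnitaryArchSingularTopFormFamily                 -- ★ `archSingularTopFormFamily`
import Literature.NumberTheory.Rogawski1990.ArchCanonicalTransferFactor                  -- ★ `archCanonicalTransferFactor_Δ`, `archGlobalSign_cast_ne_zero`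
import Literature.NumberTheory.Rogawski1990.ArchCanonicalSingularHaar                   -- ★ `isHaarMeasure_of_archCanonicalSingularMatrix`, `ArchCanonicalSingularMatrix`
import Summits.HodgeConjecture.HodgeConjecture.Theorems.K2E4ExplicitArchSingularTransferSignedDefs  -- ★ p855382 (this seat): `HStepDataSigned`, `GPrimeDataSigned`
import Summits.HodgeConjecture.HodgeConjecture.Theorems.K2E4ExplicitArchSingularTransferDefs    -- ★ (this seat) `HStepData`, `GPrimeData` (the two analytic inputs, as data)
import Summits.HodgeConjecture.HodgeConjecture.Theorems.K2E4ExplicitArchSingularTransferEngine  -- ★ (this seat) `joint_induction`, the speed-0 adapter, `νHi` Haar, curve regularity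
import HarnessLib

/-!
# `K2E4ExplicitArchSingularTransferOfPackagesSigned` — the #9 assembly ★ p855083 WITH THE PHASE OF ITS CONSTANT (for #10♯ `sig_K2E4ExplicitArchConstantPhaseSigned`; Rogawski Prop. 8.2.1 proof p. 119)
Track B ∕ K2-LIT, h413 = `stmt-HodgeConjecture-24833`; seat `hodgecm-mathlib-K2E4-p09` (g0).  THEOREMS ONLY; lane `--supports … --as helper`.  ★ p855083's proof replayed TOKEN FOR TOKEN with the
SIGNED inputs ★ p855382 `HStepDataSigned` (`C_neg`; K2E4-p13 ★ `hStepDataSigned_nonempty`) ∕ `GPrimeDataSigned` (`lam_phase`; K2E4-p14 ★ `exists_gState_univ_eq_signed`, packed by ★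
`gPrimeDataSigned_nonempty`); the conclusion's `cinf ≠ 0` is REPLACED by the phase law of the value `cinf = κ·(∏_w C_w)·2^{|W|} ∕ λ` on the EXPOSED internal rational diagonal frame:
`∃ P α′ (c(P)ᵀH′P = diag α′) h₁ h₂ y s, ↑y = (P⊗1) t_{α′}(σe₁,σe₂,σe₁) (P⊗1)⁻¹ ∧ γ₀⊗1 ∼_st y ∧ 0 < s ∧ cinf = (−1)^{|W|}·(∏_w sgn Re σ_w(α′₀α′₂))·s·conj(Tinf.Δ(h₀, y))` (`κ > 0` ★ (β₀), every
`C_w < 0`, `1∕λ = conj λ∕|λ|²`).  Converting `Tinf.Δ(h₀, y)` into `ε(H′)·τ_∞(γ_H⊗1)` (★ p855349's «signed #9») is the sheet bookkeeping of ★ p855310 — not done here.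
HONEST LABEL: HC_CM is proved only modulo the 7 printed citations (2 remaining named inputs: hLiu418 = `stmt-HodgeConjecture-24832`, h413 = `stmt-HodgeConjecture-24833`) until rung 0 closes.
References: [Rogawski1990] Ann. of Math. Stud. 123 (1990), §8.2 Prop. 8.2.1 (a) pp. 118–119, §4.3 (4.3.1) p. 43, §14.5 Lemma 14.5.2 (b)(c) p. 238; [Varadarajan1989] §6.4 Thm 22.
-/

set_option autoImplicit false
set_option linter.dupNamespace false  -- the mandated namespace repeats the single-problem summit's segment

noncomputable section

open MeasureTheory Measure NumberField NumberField.InfinitePlace NumberField.mixedEmbedding IsDedekindDomain Filter Topology Set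
open Literature.MeasureTheory.Group Literature.NumberTheory.Rogawski1990 Literature.NumberTheory.Automorphic Literature.NumberTheory.GaloisRepresentations
open Literature.AlgebraicGeometry.ShimuraVarieties (unitaryGroup hermForm)
open Summit.HodgeConjecture.HodgeConjecture.Cruxes.H413.K2E4ExplicitArchSingularTransferDefs
open Summit.HodgeConjecture.HodgeConjecture.Cruxes.H413.K2E4ExplicitArchSingularTransferSignedDefs
open Summit.HodgeConjecture.HodgeConjecture.Cruxes.H413.K2E4ExplicitArchSingularTransferEngine
open scoped Matrix MatrixGroups ComplexOrder ContDiff Classical Matrix.Norms.Operator  -- `Classical`: the place subtypes of `mixedSpace L` are `Fintype` classically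

namespace Summit.HodgeConjecture.HodgeConjecture.Cruxes.H413.K2E4ExplicitArchSingularTransferOfPackagesSigned

section Frame

variable (L : Type) [Field L] [NumberField L] [IsCMField L] (H' : Matrix (Fin 3) (Fin 3) L) (Tinf : ArchTransferFactor L H')
    [MeasurableSpace (UnitaryGroup.arch (↥(maximalRealSubfield L)) L (IsCMField.complexConj L) 3 H')] [BorelSpace (UnitaryGroup.arch (↥(maximalRealSubfield L)) L (IsCMField.complexConj L) 3 H')]
    [∀ γ : UnitaryGroup.arch (↥(maximalRealSubfield L)) L (IsCMField.complexConj L) 3 H', MeasurableSpace (UnitaryGroup.arch (↥(maximalRealSubfield L)) L (IsCMField.complexConj L) 3 H' ⧸ Subgroup.centralizer ({γ} : Set (UnitaryGroup.arch (↥(maximalRealSubfield L)) L (IsCMField.complexConj L) 3 H')))]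
    [∀ γ : UnitaryGroup.arch (↥(maximalRealSubfield L)) L (IsCMField.complexConj L) 3 H', BorelSpace (UnitaryGroup.arch (↥(maximalRealSubfield L)) L (IsCMField.complexConj L) 3 H' ⧸ Subgroup.centralizer ({γ} : Set (UnitaryGroup.arch (↥(maximalRealSubfield L)) L (IsCMField.complexConj L) 3 H')))]
    [MeasurableSpace (UnitaryGroup.arch (↥(maximalRealSubfield L)) L (IsCMField.complexConj L) 3 (Matrix.of fun i j : Fin 3 => if i.val + j.val + 1 = 3 then (1 : L) else 0))] [BorelSpace (UnitaryGroup.arch (↥(maximalRealSubfield L)) L (IsCMField.complexConj L) 3 (Matrix.of fun i j : Fin 3 => if i.val + j.val + 1 = 3 then (1 : L) else 0))]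
    [∀ γ : UnitaryGroup.arch (↥(maximalRealSubfield L)) L (IsCMField.complexConj L) 3 (Matrix.of fun i j : Fin 3 => if i.val + j.val + 1 = 3 then (1 : L) else 0),
      MeasurableSpace (UnitaryGroup.arch (↥(maximalRealSubfield L)) L (IsCMField.complexConj L) 3 (Matrix.of fun i j : Fin 3 => if i.val + j.val + 1 = 3 then (1 : L) else 0) ⧸ Subgroup.centralizer ({γ} : Set (UnitaryGroup.arch (↥(maximalRealSubfield L)) L (IsCMField.complexConj L) 3 (Matrix.of fun i j : Fin 3 => if i.val + j.val + 1 = 3 then (1 : L) else 0))))]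
    [∀ γ : UnitaryGroup.arch (↥(maximalRealSubfield L)) L (IsCMField.complexConj L) 3 (Matrix.of fun i j : Fin 3 => if i.val + j.val + 1 = 3 then (1 : L) else 0),
      BorelSpace (UnitaryGroup.arch (↥(maximalRealSubfield L)) L (IsCMField.complexConj L) 3 (Matrix.of fun i j : Fin 3 => if i.val + j.val + 1 = 3 then (1 : L) else 0) ⧸ Subgroup.centralizer ({γ} : Set (UnitaryGroup.arch (↥(maximalRealSubfield L)) L (IsCMField.complexConj L) 3 (Matrix.of fun i j : Fin 3 => if i.val + j.val + 1 = 3 then (1 : L) else 0))))]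
    [MeasurableSpace (UnitaryGroup.arch (↥(maximalRealSubfield L)) L (IsCMField.complexConj L) 2 (Matrix.of fun i j : Fin 2 => if i.val + j.val + 1 = 2 then (1 : L) else 0) ×
          UnitaryGroup.arch (↥(maximalRealSubfield L)) L (IsCMField.complexConj L) 1 (Matrix.of fun i j : Fin 1 => if i.val + j.val + 1 = 1 then (1 : L) else 0))]
    [BorelSpace (UnitaryGroup.arch (↥(maximalRealSubfield L)) L (IsCMField.complexConj L) 2 (Matrix.of fun i j : Fin 2 => if i.val + j.val + 1 = 2 then (1 : L) else 0) ×
          UnitaryGroup.arch (↥(maximalRealSubfield L)) L (IsCMField.complexConj L) 1 (Matrix.of fun i j : Fin 1 => if i.val + j.val + 1 = 1 then (1 : L) else 0))]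
    [∀ a : (UnitaryGroup.arch (↥(maximalRealSubfield L)) L (IsCMField.complexConj L) 2 (Matrix.of fun i j : Fin 2 => if i.val + j.val + 1 = 2 then (1 : L) else 0) ×
          UnitaryGroup.arch (↥(maximalRealSubfield L)) L (IsCMField.complexConj L) 1 (Matrix.of fun i j : Fin 1 => if i.val + j.val + 1 = 1 then (1 : L) else 0)),
      MeasurableSpace ((UnitaryGroup.arch (↥(maximalRealSubfield L)) L (IsCMField.complexConj L) 2 (Matrix.of fun i j : Fin 2 => if i.val + j.val + 1 = 2 then (1 : L) else 0) ×
          UnitaryGroup.arch (↥(maximalRealSubfield L)) L (IsCMField.complexConj L) 1 (Matrix.of fun i j : Fin 1 => if i.val + j.val + 1 = 1 then (1 : L) else 0)) ⧸ Subgroup.centralizer ({a} : Set (UnitaryGroup.arch (↥(maximalRealSubfield L)) L (IsCMField.complexConj L) 2 (Matrix.of fun i j : Fin 2 => if i.val + j.val + 1 = 2 then (1 : L) else 0) ×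
          UnitaryGroup.arch (↥(maximalRealSubfield L)) L (IsCMField.complexConj L) 1 (Matrix.of fun i j : Fin 1 => if i.val + j.val + 1 = 1 then (1 : L) else 0))))]
    [∀ a : (UnitaryGroup.arch (↥(maximalRealSubfield L)) L (IsCMField.complexConj L) 2 (Matrix.of fun i j : Fin 2 => if i.val + j.val + 1 = 2 then (1 : L) else 0) ×
          UnitaryGroup.arch (↥(maximalRealSubfield L)) L (IsCMField.complexConj L) 1 (Matrix.of fun i j : Fin 1 => if i.val + j.val + 1 = 1 then (1 : L) else 0)),
      BorelSpace ((UnitaryGroup.arch (↥(maximalRealSubfield L)) L (IsCMField.complexConj L) 2 (Matrix.of fun i j : Fin 2 => if i.val + j.val + 1 = 2 then (1 : L) else 0) ×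
          UnitaryGroup.arch (↥(maximalRealSubfield L)) L (IsCMField.complexConj L) 1 (Matrix.of fun i j : Fin 1 => if i.val + j.val + 1 = 1 then (1 : L) else 0)) ⧸ Subgroup.centralizer ({a} : Set (UnitaryGroup.arch (↥(maximalRealSubfield L)) L (IsCMField.complexConj L) 2 (Matrix.of fun i j : Fin 2 => if i.val + j.val + 1 = 2 then (1 : L) else 0) ×
          UnitaryGroup.arch (↥(maximalRealSubfield L)) L (IsCMField.complexConj L) 1 (Matrix.of fun i j : Fin 1 => if i.val + j.val + 1 = 1 then (1 : L) else 0))))]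
    (νGi : Measure (UnitaryGroup.arch (↥(maximalRealSubfield L)) L (IsCMField.complexConj L) 3 H')) (νqi : Measure (UnitaryGroup.arch (↥(maximalRealSubfield L)) L (IsCMField.complexConj L) 3 (Matrix.of fun i j : Fin 3 => if i.val + j.val + 1 = 3 then (1 : L) else 0)))
    (νHi : Measure (UnitaryGroup.arch (↥(maximalRealSubfield L)) L (IsCMField.complexConj L) 2 (Matrix.of fun i j : Fin 2 => if i.val + j.val + 1 = 2 then (1 : L) else 0) ×
          UnitaryGroup.arch (↥(maximalRealSubfield L)) L (IsCMField.complexConj L) 1 (Matrix.of fun i j : Fin 1 => if i.val + j.val + 1 = 1 then (1 : L) else 0)))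
    [IsFiniteMeasureOnCompacts νGi] [νGi.IsMulRightInvariant] [IsFiniteMeasureOnCompacts νqi] [νqi.IsMulRightInvariant]
    [IsFiniteMeasureOnCompacts νHi] [νHi.IsMulRightInvariant]

set_option maxHeartbeats 16000000 in set_option synthInstance.maxHeartbeats 800000 in
/-- **SOCKET #9 WITH THE PHASE OF ITS CONSTANT** from the SIGNED inputs `hHs` (`C_w < 0`), `hGs` (`lam_phase`) and `hTr`: the transfer identity of #9 with
`cinf = (−1)^{|W|}·(∏_w sgn Re σ_w(α′₀α′₂))·s·conj(Tinf.Δ(h₀, y))`, `s > 0`, on an exposed rational diagonal frame `(P, α′)` of `H′`, `y = (P⊗1) t_{α′}(σe₁,σe₂,σe₁) (P⊗1)⁻¹ ∼_st γ₀⊗1`.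
[cite: Rogawski1990, §8.2 Prop. 8.2.1 (a) pp. 118–119; §14.5 Lemma 14.5.2 (b)(c) p. 238] [cite: Varadarajan1989, §6.4 Thm 22] -/
theorem explicitArchSingularTransfer_of_packages_signed
    (hHs : ∀ [∀ w : {w : InfinitePlace L // IsComplex w}, MeasurableSpace (UnitaryGroup.archLocal L 2 (Matrix.diagonal ![(2 : L)⁻¹, -(2 : L)⁻¹]) w)] [∀ w : {w : InfinitePlace L // IsComplex w}, BorelSpace (UnitaryGroup.archLocal L 2 (Matrix.diagonal ![(2 : L)⁻¹, -(2 : L)⁻¹]) w)]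
        (νw : ∀ w : {w : InfinitePlace L // IsComplex w}, Measure (UnitaryGroup.archLocal L 2 (Matrix.diagonal ![(2 : L)⁻¹, -(2 : L)⁻¹]) w)) [∀ w, (νw w).IsHaarMeasure] (z : {w : InfinitePlace L // IsComplex w} → Circle) (w₁ : {w : InfinitePlace L // IsComplex w}), HStepDataSigned L νw z w₁)
    (hGs : ∀ (α : Fin 3 → L) (_hα : ∀ i, α i ≠ 0) (_hαh : ∀ i, (IsCMField.complexConj L (α i) : L) = α i)
        [MeasurableSpace (UnitaryGroup.arch (↥(maximalRealSubfield L)) L (IsCMField.complexConj L) 3 (Matrix.diagonal α))] [BorelSpace (UnitaryGroup.arch (↥(maximalRealSubfield L)) L (IsCMField.complexConj L) 3 (Matrix.diagonal α))]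
        [∀ γ : UnitaryGroup.arch (↥(maximalRealSubfield L)) L (IsCMField.complexConj L) 3 (Matrix.diagonal α), MeasurableSpace (UnitaryGroup.arch (↥(maximalRealSubfield L)) L (IsCMField.complexConj L) 3 (Matrix.diagonal α) ⧸ Subgroup.centralizer ({γ} : Set (UnitaryGroup.arch (↥(maximalRealSubfield L)) L (IsCMField.complexConj L) 3 (Matrix.diagonal α))))]
        [∀ γ : UnitaryGroup.arch (↥(maximalRealSubfield L)) L (IsCMField.complexConj L) 3 (Matrix.diagonal α), BorelSpace (UnitaryGroup.arch (↥(maximalRealSubfield L)) L (IsCMField.complexConj L) 3 (Matrix.diagonal α) ⧸ Subgroup.centralizer ({γ} : Set (UnitaryGroup.arch (↥(maximalRealSubfield L)) L (IsCMField.complexConj L) 3 (Matrix.diagonal α))))]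
        (T' : ArchTransferFactor L (Matrix.diagonal α)) (μω : HeckeCharacter L) (_hμu : μω.IsUnitary)
        (_hμω : ∀ x : ideleGroup ↥(maximalRealSubfield L), μω (AdeleRing.ideleBaseChange (↥(maximalRealSubfield L)) L x) = quadraticHeckeCharCM L x)
        (c : ℂ) (_hc : c ≠ 0) (_hT' : ∀ a b, T'.Δ a b = c * archExplicitDelta L (Matrix.diagonal α) a μω b)
        (ν : Measure (UnitaryGroup.arch (↥(maximalRealSubfield L)) L (IsCMField.complexConj L) 3 (Matrix.diagonal α))) [ν.IsHaarMeasure] [ν.IsMulRightInvariant]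
        (e₁ e₂ : L) (h₁ : (IsCMField.complexConj L e₁ : L) * e₁ = 1) (h₂ : (IsCMField.complexConj L e₂ : L) * e₂ = 1) (_hne : e₁ ≠ e₂),
        GPrimeDataSigned L α T' ν e₁ e₂ h₁ h₂)
    (hTr : ∀ (α : Fin 3 → L) (P₀ : GL (Fin 3) L) (_hPα : formCongr (cmConjRingHom L) P₀ H' = Matrix.diagonal α)
        [MeasurableSpace (UnitaryGroup.arch (↥(maximalRealSubfield L)) L (IsCMField.complexConj L) 3 (Matrix.diagonal α))] [BorelSpace (UnitaryGroup.arch (↥(maximalRealSubfield L)) L (IsCMField.complexConj L) 3 (Matrix.diagonal α))]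
        [∀ γ : UnitaryGroup.arch (↥(maximalRealSubfield L)) L (IsCMField.complexConj L) 3 (Matrix.diagonal α), MeasurableSpace (UnitaryGroup.arch (↥(maximalRealSubfield L)) L (IsCMField.complexConj L) 3 (Matrix.diagonal α) ⧸ Subgroup.centralizer ({γ} : Set (UnitaryGroup.arch (↥(maximalRealSubfield L)) L (IsCMField.complexConj L) 3 (Matrix.diagonal α))))]
        [∀ γ : UnitaryGroup.arch (↥(maximalRealSubfield L)) L (IsCMField.complexConj L) 3 (Matrix.diagonal α), BorelSpace (UnitaryGroup.arch (↥(maximalRealSubfield L)) L (IsCMField.complexConj L) 3 (Matrix.diagonal α) ⧸ Subgroup.centralizer ({γ} : Set (UnitaryGroup.arch (↥(maximalRealSubfield L)) L (IsCMField.complexConj L) 3 (Matrix.diagonal α))))]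
        (Φ : UnitaryGroup.arch (↥(maximalRealSubfield L)) L (IsCMField.complexConj L) 3 (Matrix.diagonal α) ≃ₜ* UnitaryGroup.arch (↥(maximalRealSubfield L)) L (IsCMField.complexConj L) 3 H')
        (_hΦ : ∀ g, ((Φ g : UnitaryGroup.arch (↥(maximalRealSubfield L)) L (IsCMField.complexConj L) 3 H') : GL (Fin 3) (mixedEmbedding.mixedSpace L)) =
          Matrix.GeneralLinearGroup.map (mixedEmbedding L) P₀ * (g : GL (Fin 3) (mixedEmbedding.mixedSpace L)) * (Matrix.GeneralLinearGroup.map (mixedEmbedding L) P₀)⁻¹)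
        [νGi.IsHaarMeasure] (ν₂ : Measure (UnitaryGroup.arch (↥(maximalRealSubfield L)) L (IsCMField.complexConj L) 3 (Matrix.diagonal α))) [ν₂.IsHaarMeasure] [ν₂.IsMulRightInvariant] (_hν₂ : ν₂ = νGi.map Φ.symm)
        (a : UnitaryGroup.arch (↥(maximalRealSubfield L)) L (IsCMField.complexConj L) 3 H' → ℂ) (x : UnitaryGroup.arch (↥(maximalRealSubfield L)) L (IsCMField.complexConj L) 3 H') (y : UnitaryGroup.arch (↥(maximalRealSubfield L)) L (IsCMField.complexConj L) 3 (Matrix.diagonal α)),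
        IsStablyConj (UnitaryGroup.conjMixed (↥(maximalRealSubfield L)) L (IsCMField.complexConj L)) (UnitaryGroup.archFormOf L 3 (Matrix.diagonal α)) (Φ.symm x) y →
        (∀ x' : UnitaryGroup.arch (↥(maximalRealSubfield L)) L (IsCMField.complexConj L) 3 H', IsStablyConj (UnitaryGroup.conjMixed (↥(maximalRealSubfield L)) L (IsCMField.complexConj L)) (UnitaryGroup.archFormOf L 3 H') x x' →
          ∃ (a₀ b₀ : L) (T₀ : GL (Fin 3) (mixedEmbedding.mixedSpace L)) (Ha : Matrix (Fin 2) (Fin 2) L) (Hb : Matrix (Fin 1) (Fin 1) L),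
            Literature.NumberTheory.Weil1964.UnitaryArchTopForm.IsSingularArchFrame L H' x' a₀ b₀ T₀ Ha Hb) →
        archStableOrbitalIntegral L 3 H' (Literature.NumberTheory.Weil1964.UnitaryArchTopForm.archSingularTopFormFamily L H' νGi) a x =
          archStableOrbitalIntegral L 3 (Matrix.diagonal α) (Literature.NumberTheory.Weil1964.UnitaryArchTopForm.archSingularTopFormFamily L (Matrix.diagonal α) ν₂) (a ∘ Φ) y)
    (hanis : ∀ x : Fin 3 → L, hermForm (cmConjRingHom L) H' x x = 0 → x = 0)
    (m' : OrbitalMeasureFamily (UnitaryGroup.arch (↥(maximalRealSubfield L)) L (IsCMField.complexConj L) 3 H')) (m : OrbitalMeasureFamily (UnitaryGroup.arch (↥(maximalRealSubfield L)) L (IsCMField.complexConj L) 3 (Matrix.of fun i j : Fin 3 => if i.val + j.val + 1 = 3 then (1 : L) else 0)))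
    (mHi : OrbitalMeasureFamily (UnitaryGroup.arch (↥(maximalRealSubfield L)) L (IsCMField.complexConj L) 2 (Matrix.of fun i j : Fin 2 => if i.val + j.val + 1 = 2 then (1 : L) else 0) ×
          UnitaryGroup.arch (↥(maximalRealSubfield L)) L (IsCMField.complexConj L) 1 (Matrix.of fun i j : Fin 1 => if i.val + j.val + 1 = 1 then (1 : L) else 0)))
    (t' : ∀ γ' : UnitaryGroup.arch (↥(maximalRealSubfield L)) L (IsCMField.complexConj L) 3 H', Measure (Subgroup.centralizer ({γ'} : Set (UnitaryGroup.arch (↥(maximalRealSubfield L)) L (IsCMField.complexConj L) 3 H'))))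
    (t : ∀ γ : UnitaryGroup.arch (↥(maximalRealSubfield L)) L (IsCMField.complexConj L) 3 (Matrix.of fun i j : Fin 3 => if i.val + j.val + 1 = 3 then (1 : L) else 0),
      Measure (Subgroup.centralizer ({γ} : Set (UnitaryGroup.arch (↥(maximalRealSubfield L)) L (IsCMField.complexConj L) 3 (Matrix.of fun i j : Fin 3 => if i.val + j.val + 1 = 3 then (1 : L) else 0)))))
    (tH : ∀ γH : (UnitaryGroup.arch (↥(maximalRealSubfield L)) L (IsCMField.complexConj L) 2 (Matrix.of fun i j : Fin 2 => if i.val + j.val + 1 = 2 then (1 : L) else 0) ×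
          UnitaryGroup.arch (↥(maximalRealSubfield L)) L (IsCMField.complexConj L) 1 (Matrix.of fun i j : Fin 1 => if i.val + j.val + 1 = 1 then (1 : L) else 0)),
      Measure (Subgroup.centralizer ({γH} : Set (UnitaryGroup.arch (↥(maximalRealSubfield L)) L (IsCMField.complexConj L) 2 (Matrix.of fun i j : Fin 2 => if i.val + j.val + 1 = 2 then (1 : L) else 0) ×
          UnitaryGroup.arch (↥(maximalRealSubfield L)) L (IsCMField.complexConj L) 1 (Matrix.of fun i j : Fin 1 => if i.val + j.val + 1 = 1 then (1 : L) else 0)))))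
    (hherm : (H'.map (cmConjRingHom L)).transpose = H') (hACS : ArchCanonicalSingularMatrix L H' Tinf νGi νqi νHi hanis m' m mHi t' t tH)
    (μ : HeckeCharacter L) (hμu : μ.IsUnitary)
    (hμω : ∀ x : ideleGroup ↥(maximalRealSubfield L), μ (AdeleRing.ideleBaseChange (↥(maximalRealSubfield L)) L x) = quadraticHeckeCharCM L x)
    (hTinf : Tinf = archCanonicalTransferFactor L H' μ) :
              ∀ (γ₀ : (UnitaryGroup.cmDatum L 3 H').Rational) (e₁ e₂ : L), e₁ ≠ e₂ →
                ((((γ₀ : unitaryGroup (cmConjRingHom L) H').val : GL (Fin 3) L) : Matrix (Fin 3) (Fin 3) L) - e₁ • (1 : Matrix (Fin 3) (Fin 3) L)) * ((((γ₀ : unitaryGroup (cmConjRingHom L) H').val : GL (Fin 3) L) : Matrix (Fin 3) (Fin 3) L) - e₂ • (1 : Matrix (Fin 3) (Fin 3) L)) = 0 →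
                (¬ ∃ ζ : L, (((γ₀ : unitaryGroup (cmConjRingHom L) H').val : GL (Fin 3) L) : Matrix (Fin 3) (Fin 3) L) = ζ • (1 : Matrix (Fin 3) (Fin 3) L)) →
                (((γ₀ : unitaryGroup (cmConjRingHom L) H').val : GL (Fin 3) L) : Matrix (Fin 3) (Fin 3) L).charpoly =
                  (Polynomial.X - Polynomial.C e₁) ^ 2 * (Polynomial.X - Polynomial.C e₂) →
                ∀ (γH : (UnitaryGroup.cmDatum L 2 (Matrix.of fun i j : Fin 2 => if i.val + j.val + 1 = 2 then (1 : L) else 0)).Rational ×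
                    (UnitaryGroup.cmDatum L 1 (Matrix.of fun i j : Fin 1 => if i.val + j.val + 1 = 1 then (1 : L) else 0)).Rational),
                  (((γH.1 : unitaryGroup (cmConjRingHom L) (Matrix.of fun i j : Fin 2 => if i.val + j.val + 1 = 2 then (1 : L) else 0)).val : GL (Fin 2) L) : Matrix (Fin 2) (Fin 2) L) =
                    e₁ • (1 : Matrix (Fin 2) (Fin 2) L) →
                  (((γH.2 : unitaryGroup (cmConjRingHom L) (Matrix.of fun i j : Fin 1 => if i.val + j.val + 1 = 1 then (1 : L) else 0)).val : GL (Fin 1) L) : Matrix (Fin 1) (Fin 1) L) 0 0 = e₂ →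
                  ∃ cinf : ℂ,
                    (∃ (P : GL (Fin 3) L) (α' : Fin 3 → L) (_ : formCongr (cmConjRingHom L) P H' = Matrix.diagonal α')
                        (h₁ : (IsCMField.complexConj L e₁ : L) * e₁ = 1) (h₂ : (IsCMField.complexConj L e₂ : L) * e₂ = 1)
                        (y : UnitaryGroup.arch (↥(maximalRealSubfield L)) L (IsCMField.complexConj L) 3 H') (s : ℝ),
                      (y : GL (Fin 3) (mixedSpace L)) = Matrix.GeneralLinearGroup.map (mixedEmbedding L) P *
                          ((UnitaryGroup.archDiagTorus L 3 α' fun w => ![(⟨w.1.embedding e₁, mem_sphere_zero_iff_norm.mpr (UnitaryGroup.norm_embedding_eq_one_of_complexConj_mul_self L e₁ h₁ w)⟩ : Circle), ⟨w.1.embedding e₂, mem_sphere_zero_iff_norm.mpr (UnitaryGroup.norm_embedding_eq_one_of_complexConj_mul_self L e₂ h₂ w)⟩, ⟨w.1.embedding e₁, mem_sphere_zero_iff_norm.mpr (UnitaryGroup.norm_embedding_eq_one_of_complexConj_mul_self L e₁ h₁ w)⟩] : UnitaryGroup.arch (↥(maximalRealSubfield L)) L (IsCMField.complexConj L) 3 (Matrix.diagonal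 α')) : GL (Fin 3) (mixedSpace L)) *
                          (Matrix.GeneralLinearGroup.map (mixedEmbedding L) P)⁻¹ ∧
                      IsStablyConj (UnitaryGroup.conjMixed (↥(maximalRealSubfield L)) L (IsCMField.complexConj L)) (UnitaryGroup.archFormOf L 3 H') (cmRationalToArch L 3 H' γ₀) y ∧
                      0 < s ∧
                      cinf = (-1) ^ Fintype.card {w : InfinitePlace L // IsComplex w} * ((∏ w : {w : InfinitePlace L // IsComplex w}, (SignType.sign ((w.1.embedding (α' 0 * α' 2)).re) : ℤ)) : ℂ) * (s : ℂ) *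
                        (starRingEnd ℂ) (Tinf.Δ
                          ((unitaryGroupOfFormCongrOfEq (UnitaryGroup.conjMixed (↥(maximalRealSubfield L)) L (IsCMField.complexConj L))
                              (Matrix.GeneralLinearGroup.map (mixedEmbedding L) (Matrix.GeneralLinearGroup.mkOfDetNeZero !![(1 : L), 1; 1, -1] (UnitaryGroup.det_quasiSplitFrameTwo_ne_zero L)))
                              (UnitaryGroup.archFormOf L 2 (Matrix.diagonal ![(2 : L)⁻¹, -(2 : L)⁻¹])) (UnitaryGroup.archFormOf L 2 (Matrix.of fun i j : Fin 2 => if i.val + j.val + 1 = 2 then (1 : L) else 0))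
                              (UnitaryGroup.formCongr_map_mixedEmbedding_archFormOf_eq L (UnitaryGroup.formCongr_quasiSplitFrameTwo_diagonal L))).symm
                              (UnitaryGroup.archDiagTorus L 2 ![(2 : L)⁻¹, -(2 : L)⁻¹] fun w => ![(⟨w.1.embedding e₁, mem_sphere_zero_iff_norm.mpr (UnitaryGroup.norm_embedding_eq_one_of_complexConj_mul_self L e₁ h₁ w)⟩ : Circle), ⟨w.1.embedding e₁, mem_sphere_zero_iff_norm.mpr (UnitaryGroup.norm_embedding_eq_one_of_complexConj_mul_self L e₁ h₁ w)⟩]),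
                            (UnitaryGroup.archPiEquivCM 1 L (Matrix.of fun i j : Fin 1 => if i.val + j.val + 1 = 1 then (1 : L) else 0)).symm fun w =>
                              ⟨UnitaryGroup.circleDiagonal 1 ![(⟨w.1.embedding e₂, mem_sphere_zero_iff_norm.mpr (UnitaryGroup.norm_embedding_eq_one_of_complexConj_mul_self L e₂ h₂ w)⟩ : Circle)], UnitaryGroup.circleDiagonal_mem_archLocal_antidiagOne L w _⟩)
                          y)) ∧
                    (∀ (aH : UnitaryGroup.arch (↥(maximalRealSubfield L)) L (IsCMField.complexConj L) 2 (Matrix.of fun i j : Fin 2 => if i.val + j.val + 1 = 2 then (1 : L) else 0) ×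
                            UnitaryGroup.arch (↥(maximalRealSubfield L)) L (IsCMField.complexConj L) 1 (Matrix.of fun i j : Fin 1 => if i.val + j.val + 1 = 1 then (1 : L) else 0) → ℂ)
                          (a : UnitaryGroup.arch (↥(maximalRealSubfield L)) L (IsCMField.complexConj L) 3 H' → ℂ),
                        ArchSmooth L 3 H' a → ArchSmooth₂ L aH → IsArchDeltaTransfer L H' Tinf mHi m' aH a →
                        archStableOrbitalIntegral L 3 H' (Literature.NumberTheory.Weil1964.UnitaryArchTopForm.archSingularTopFormFamily L H' νGi) a (cmRationalToArch L 3 H' γ₀) =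
                          cinf * aH (cmRationalToArch L 2 (Matrix.of fun i j : Fin 2 => if i.val + j.val + 1 = 2 then (1 : L) else 0) γH.1, cmRationalToArch L 1 (Matrix.of fun i j : Fin 1 => if i.val + j.val + 1 = 1 then (1 : L) else 0) γH.2)) := by
  intro γ₀ e₁ e₂ hne hprod hnsc hchar γH hγ1 hγ2
  have hACS' := hACS
  obtain ⟨hadm', -, hadmH, -, -, hexist, hW', -, hWH, -, hC, hC'G, hCH, -, -⟩ := hACS'
  have hd' : H'.det ≠ 0 := Godement.det_ne_zero_of_anisotropic L H' hanis
  have hd₃ : (Matrix.of fun i j : Fin 3 => if i.val + j.val + 1 = 3 then (1 : L) else 0).det ≠ 0 := (UnitaryGroup.isUnit_antidiagOne_det L 3).ne_zero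
  haveI : νGi.IsHaarMeasure := isHaarMeasure_of_archCanonicalSingularMatrix L H' Tinf νGi νqi νHi hanis m' m mHi t' t tH hherm hACS
  have hT : ∀ a b, Tinf.Δ a b = ((archGlobalSign L H' : ℤ) : ℂ) * archExplicitDelta L H' a μ b := by
    intro a b; rw [hTinf]; exact archCanonicalTransferFactor_Δ L H' μ a b
  have hc₀ : ((archGlobalSign L H' : ℤ) : ℂ) ≠ 0 := archGlobalSign_cast_ne_zero L H'
  obtain ⟨P, α', hPα⟩ := exists_formCongr_eq_diagonal L H' hherm hanis
  have hherm' : ((Matrix.diagonal α').map (cmConjRingHom L))ᵀ = Matrix.diagonal α' := by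
    have h := UnitaryGroup.transpose_map_formCongr_cm L P hherm; rwa [hPα] at h
  have hanis' : ∀ x : Fin 3 → L, hermForm (cmConjRingHom L) (Matrix.diagonal α') x x = 0 → x = 0 := by
    have h := UnitaryGroup.anisotropic_formCongr_cm L P hanis; rwa [hPα] at h
  have hα' : ∀ i, α' i ≠ 0 := by
    have hdet := Godement.det_ne_zero_of_anisotropic L (Matrix.diagonal α') hanis'
    rw [Matrix.det_diagonal] at hdet
    exact fun i => (Finset.prod_ne_zero_iff.1 hdet) i (Finset.mem_univ i)
  have hαherm : ∀ i, (IsCMField.complexConj L (α' i) : L) = α' i := by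
    intro i; have h := congrFun (congrFun hherm' i) i
    rw [Matrix.transpose_apply, Matrix.map_apply, Matrix.diagonal_apply_eq] at h
    exact h
  obtain ⟨Φ, hΦ, hΦΔ⟩ : ∃ Φ : UnitaryGroup.arch (↥(maximalRealSubfield L)) L (IsCMField.complexConj L) 3 (Matrix.diagonal α') ≃ₜ*
        UnitaryGroup.arch (↥(maximalRealSubfield L)) L (IsCMField.complexConj L) 3 H',
      (∀ g, ((Φ g : UnitaryGroup.arch (↥(maximalRealSubfield L)) L (IsCMField.complexConj L) 3 H') : GL (Fin 3) (mixedSpace L)) =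
          Matrix.GeneralLinearGroup.map (mixedEmbedding L) P * (g : GL (Fin 3) (mixedSpace L)) * (Matrix.GeneralLinearGroup.map (mixedEmbedding L) P)⁻¹) ∧
      ∀ (a : UnitaryGroup.arch (↥(maximalRealSubfield L)) L (IsCMField.complexConj L) 2 (Matrix.of fun i j : Fin 2 => if i.val + j.val + 1 = 2 then (1 : L) else 0) ×
          UnitaryGroup.arch (↥(maximalRealSubfield L)) L (IsCMField.complexConj L) 1 (Matrix.of fun i j : Fin 1 => if i.val + j.val + 1 = 1 then (1 : L) else 0)) g,
        archExplicitDelta L H' a μ (Φ g) = archExplicitDelta L (Matrix.diagonal α') a μ g :=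
    ⟨_, UnitaryGroup.coe_archCongrOfEq_apply L hPα, fun a g => archExplicitDelta_archCongrOfEq L hPα a μ g⟩
  have hΦsymm : ∀ g, ((Φ.symm g : UnitaryGroup.arch (↥(maximalRealSubfield L)) L (IsCMField.complexConj L) 3 (Matrix.diagonal α')) : GL (Fin 3) (mixedSpace L)) =
      (Matrix.GeneralLinearGroup.map (mixedEmbedding L) P)⁻¹ * (g : GL (Fin 3) (mixedSpace L)) * ((Matrix.GeneralLinearGroup.map (mixedEmbedding L) P)⁻¹)⁻¹ := by
    intro g; have h := hΦ (Φ.symm g); rw [ContinuousMulEquiv.apply_symm_apply] at h; rw [inv_inv, h]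
    simp only [← mul_assoc, inv_mul_cancel, one_mul, inv_mul_cancel_right]
  letI iD : MeasurableSpace (UnitaryGroup.arch (↥(maximalRealSubfield L)) L (IsCMField.complexConj L) 3 (Matrix.diagonal α')) := borel _
  haveI iDB : BorelSpace (UnitaryGroup.arch (↥(maximalRealSubfield L)) L (IsCMField.complexConj L) 3 (Matrix.diagonal α')) := ⟨rfl⟩
  letI iDQ : ∀ γ : UnitaryGroup.arch (↥(maximalRealSubfield L)) L (IsCMField.complexConj L) 3 (Matrix.diagonal α'),
      MeasurableSpace (UnitaryGroup.arch (↥(maximalRealSubfield L)) L (IsCMField.complexConj L) 3 (Matrix.diagonal α') ⧸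
        Subgroup.centralizer ({γ} : Set (UnitaryGroup.arch (↥(maximalRealSubfield L)) L (IsCMField.complexConj L) 3 (Matrix.diagonal α')))) := fun _ => borel _
  haveI iDQB : ∀ γ : UnitaryGroup.arch (↥(maximalRealSubfield L)) L (IsCMField.complexConj L) 3 (Matrix.diagonal α'),
      BorelSpace (UnitaryGroup.arch (↥(maximalRealSubfield L)) L (IsCMField.complexConj L) 3 (Matrix.diagonal α') ⧸
        Subgroup.centralizer ({γ} : Set (UnitaryGroup.arch (↥(maximalRealSubfield L)) L (IsCMField.complexConj L) 3 (Matrix.diagonal α')))) := fun _ => ⟨rfl⟩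
  haveI : (νGi.map Φ.symm).IsHaarMeasure := ContinuousMulEquiv.isHaarMeasure_map νGi Φ.symm
  haveI : (νGi.map Φ.symm).IsMulRightInvariant := isMulRightInvariant_map_mulEquiv_of_isMulRightInvariant Φ.symm.toMulEquiv Φ.symm.continuous.measurable νGi
  have hTΦ : ∀ a b, (Tinf.comap Φ.toMulEquiv (isArchNormPair_of_archCongr L _ Φ hΦ) : ArchTransferFactor L (Matrix.diagonal α')).Δ a b =
      ((archGlobalSign L H' : ℤ) : ℂ) * archExplicitDelta L (Matrix.diagonal α') a μ b := fun a b =>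
    calc (Tinf.comap Φ.toMulEquiv (isArchNormPair_of_archCongr L _ Φ hΦ) : ArchTransferFactor L (Matrix.diagonal α')).Δ a b = Tinf.Δ a (Φ b) := rfl
      _ = ((archGlobalSign L H' : ℤ) : ℂ) * archExplicitDelta L H' a μ (Φ b) := hT a (Φ b)
      _ = ((archGlobalSign L H' : ℤ) : ℂ) * archExplicitDelta L (Matrix.diagonal α') a μ b := by rw [hΦΔ]
  obtain ⟨h₁, h₂, hwall⟩ := exists_isStablyConj_cmRationalToArch_archDiagTorus_wall L H' α' ((Matrix.GeneralLinearGroup.map (mixedEmbedding L) P)⁻¹) Φ.symm hΦsymm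
    hherm hanis γ₀ hne hprod hnsc hchar
  set zc : {w : InfinitePlace L // IsComplex w} → Circle :=
    fun w => ⟨w.1.embedding e₁, mem_sphere_zero_iff_norm.mpr (UnitaryGroup.norm_embedding_eq_one_of_complexConj_mul_self L e₁ h₁ w)⟩ with hzc
  set δc : {w : InfinitePlace L // IsComplex w} → Circle :=
    fun w => ⟨w.1.embedding e₂, mem_sphere_zero_iff_norm.mpr (UnitaryGroup.norm_embedding_eq_one_of_complexConj_mul_self L e₂ h₂ w)⟩ with hδc
  have hzδ : ∀ w, zc w ≠ δc w := by
    intro w h; exact hne (w.1.embedding.injective (congrArg (fun x : Circle => (x : ℂ)) h))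
  set δpt : UnitaryGroup.arch (↥(maximalRealSubfield L)) L (IsCMField.complexConj L) 1 (Matrix.of fun i j : Fin 1 => if i.val + j.val + 1 = 1 then (1 : L) else 0) :=
    (UnitaryGroup.archPiEquivCM 1 L (Matrix.of fun i j : Fin 1 => if i.val + j.val + 1 = 1 then (1 : L) else 0)).symm fun w =>
      ⟨UnitaryGroup.circleDiagonal 1 ![δc w], UnitaryGroup.circleDiagonal_mem_archLocal_antidiagOne L w _⟩ with hδpt
  letI iw : ∀ w : {w : InfinitePlace L // IsComplex w}, MeasurableSpace (UnitaryGroup.archLocal L 2 (Matrix.diagonal ![(2 : L)⁻¹, -(2 : L)⁻¹]) w) := fun _ => borel _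
  haveI iwB : ∀ w : {w : InfinitePlace L // IsComplex w}, BorelSpace (UnitaryGroup.archLocal L 2 (Matrix.diagonal ![(2 : L)⁻¹, -(2 : L)⁻¹]) w) := fun _ => ⟨rfl⟩
  haveI : ∀ w : {w : InfinitePlace L // IsComplex w}, LocallyCompactSpace (UnitaryGroup.archLocal L 2 (Matrix.diagonal ![(2 : L)⁻¹, -(2 : L)⁻¹]) w) :=
    fun w => UnitaryGroup.locallyCompactSpace_archLocal L 2 _ w
  let νw : ∀ w : {w : InfinitePlace L // IsComplex w}, Measure (UnitaryGroup.archLocal L 2 (Matrix.diagonal ![(2 : L)⁻¹, -(2 : L)⁻¹]) w) := fun _ => Measure.haar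
  haveI : ∀ w, (νw w).IsHaarMeasure := fun _ => inferInstance
  set Ψq : UnitaryGroup.arch (↥(maximalRealSubfield L)) L (IsCMField.complexConj L) 2 (Matrix.of fun i j : Fin 2 => if i.val + j.val + 1 = 2 then (1 : L) else 0) ≃ₜ*
      UnitaryGroup.arch (↥(maximalRealSubfield L)) L (IsCMField.complexConj L) 2 (Matrix.diagonal ![(2 : L)⁻¹, -(2 : L)⁻¹]) :=
    unitaryGroupOfFormCongrOfEq (UnitaryGroup.conjMixed (↥(maximalRealSubfield L)) L (IsCMField.complexConj L))
      (Matrix.GeneralLinearGroup.map (mixedEmbedding L) (Matrix.GeneralLinearGroup.mkOfDetNeZero !![(1 : L), 1; 1, -1] (UnitaryGroup.det_quasiSplitFrameTwo_ne_zero L)))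
      (UnitaryGroup.archFormOf L 2 (Matrix.diagonal ![(2 : L)⁻¹, -(2 : L)⁻¹])) (UnitaryGroup.archFormOf L 2 (Matrix.of fun i j : Fin 2 => if i.val + j.val + 1 = 2 then (1 : L) else 0))
      (UnitaryGroup.formCongr_map_mixedEmbedding_archFormOf_eq L (UnitaryGroup.formCongr_quasiSplitFrameTwo_diagonal L)) with hΨqdef
  have hΨq : ∀ x, ((Ψq x : UnitaryGroup.arch (↥(maximalRealSubfield L)) L (IsCMField.complexConj L) 2 (Matrix.diagonal ![(2 : L)⁻¹, -(2 : L)⁻¹])) : GL (Fin 2) (mixedSpace L)) =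
      Matrix.GeneralLinearGroup.map (mixedEmbedding L) (Matrix.GeneralLinearGroup.mkOfDetNeZero !![(1 : L), 1; 1, -1] (UnitaryGroup.det_quasiSplitFrameTwo_ne_zero L)) *
        (x : GL (Fin 2) (mixedSpace L)) * (Matrix.GeneralLinearGroup.map (mixedEmbedding L) (Matrix.GeneralLinearGroup.mkOfDetNeZero !![(1 : L), 1; 1, -1] (UnitaryGroup.det_quasiSplitFrameTwo_ne_zero L)))⁻¹ :=
    fun x => UnitaryGroup.coe_archCongrOfEq_apply L (UnitaryGroup.formCongr_quasiSplitFrameTwo_diagonal L) x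
  have hpt : ∀ u : {w : InfinitePlace L // IsComplex w} → Fin 2 → Circle, (∀ w, u w 0 ≠ u w 1 ∧ u w 0 ≠ δc w ∧ u w 1 ≠ δc w) →
      IsArchGRegular L (Ψq.symm (UnitaryGroup.archDiagTorus L 2 ![(2 : L)⁻¹, -(2 : L)⁻¹] u), δpt) ∧
      ∀ γ', IsArchNormPair L H' (Ψq.symm (UnitaryGroup.archDiagTorus L 2 ![(2 : L)⁻¹, -(2 : L)⁻¹] u), δpt) γ' →
        CompactSpace (Subgroup.centralizer ({γ'} : Set (UnitaryGroup.arch (↥(maximalRealSubfield L)) L (IsCMField.complexConj L) 3 H'))) :=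
    fun u hu => twoBlockPoint_isArchGRegular_and_compactSpace L H' α' hα' hαherm P Φ hΦ e₂ h₂ u hu
  obtain ⟨u₁, hu₁⟩ : ∃ u₁ : {w : InfinitePlace L // IsComplex w} → Fin 2 → Circle, u₁ = fun w => ![δc w * Circle.exp (1 / 2 : ℝ), δc w * Circle.exp (-(1 / 2 : ℝ))] := ⟨_, rfl⟩
  have hu₁reg : ∀ w, u₁ w 0 ≠ u₁ w 1 ∧ u₁ w 0 ≠ δc w ∧ u₁ w 1 ≠ δc w := by
    intro w; have h12 : (1 / 2 : ℝ) ∈ Ioo (-1 : ℝ) 1 := ⟨by norm_num, by norm_num⟩; have h0 : (1 / 2 : ℝ) ≠ 0 := by norm_num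
    rw [hu₁]
    exact ⟨UnitaryGroup.mul_exp_ne_mul_exp_neg _ h12 h0, UnitaryGroup.mul_exp_ne_self _ h12 h0, UnitaryGroup.mul_exp_neg_ne_self _ h12 h0⟩
  haveI : νHi.IsHaarMeasure :=
    isHaarMeasure_H_of_isQuotientOf L νHi mHi tH hWH hadmH _ (hpt u₁ hu₁reg).1
  obtain ⟨κ, hκ, hβ₀⟩ := exists_sum_integral_pi_eq_inv_mul_finsum_delta L H' tH t' t (Godement.det_ne_zero_of_anisotropic L H' hanis) hd₃ hC hC'G hCH Tinf νGi νHi mHi m' hWH hW'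
    (![(2 : L)⁻¹, -(2 : L)⁻¹]) (UnitaryGroup.quasiSplitWeightsTwo_ne_zero (L := L)) (fun i => UnitaryGroup.cmConjRingHom_quasiSplitWeightsTwo L i)
    (UnitaryGroup.re_embedding_quasiSplitWeightsTwo_mul_neg L) νw
    (Matrix.GeneralLinearGroup.map (mixedEmbedding L) (Matrix.GeneralLinearGroup.mkOfDetNeZero !![(1 : L), 1; 1, -1] (UnitaryGroup.det_quasiSplitFrameTwo_ne_zero L)))
    Ψq hΨq zc Finset.univ rfl
  set C : {w : InfinitePlace L // IsComplex w} → ℝ := fun w₁ => (hHs νw zc w₁).C with hCdef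
  have hC0 : ∀ w, C w ≠ 0 := fun w => (hHs νw zc w).C_ne_zero; have hCstep := fun w => (hHs νw zc w).tendsto
  set 𝒢 := hGs α' hα' hαherm (Tinf.comap Φ.toMulEquiv (isArchNormPair_of_archCongr L _ Φ hΦ)) μ hμu hμω _ hc₀ hTΦ (νGi.map Φ.symm) e₁ e₂ h₁ h₂ hne with h𝒢
  set lam : ℂ := 𝒢.lam with hlamdef; have hlam : lam ≠ 0 := 𝒢.lam_ne_zero
  have hCneg : ∀ w, C w < 0 := fun w => (hHs νw zc w).C_neg; obtain ⟨s₁, hs₁, hlaw⟩ := 𝒢.lam_phase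
  refine ⟨((κ * (∏ w, C w) * (Fintype.card ({w : InfinitePlace L // IsComplex w} → Bool) : ℝ) : ℝ) : ℂ) / lam, ?_, ?_⟩
  · -- THE PHASE LAW on the exposed frame `(P, α′)`, `y = Φ t(σe₁,σe₂,σe₁)`
    have hst : IsStablyConj (UnitaryGroup.conjMixed (↥(maximalRealSubfield L)) L (IsCMField.complexConj L)) (UnitaryGroup.archFormOf L 3 H') (cmRationalToArch L 3 H' γ₀)
        (Φ (UnitaryGroup.archDiagTorus L 3 α' fun w => ![zc w, δc w, zc w])) := by
      have h := (isStablyConj_archCongr_iff L (Matrix.GeneralLinearGroup.map (mixedEmbedding L) P) Φ hΦ (Φ.symm (cmRationalToArch L 3 H' γ₀))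
        (UnitaryGroup.archDiagTorus L 3 α' fun w => ![zc w, δc w, zc w])).2 hwall
      rwa [ContinuousMulEquiv.apply_symm_apply] at h
    have hprod : (∏ w, C w) = (-1) ^ Fintype.card {w : InfinitePlace L // IsComplex w} * ∏ w, (-C w) := by
      rw [Finset.prod_neg, Finset.card_univ, ← mul_assoc, ← mul_pow, neg_one_mul, neg_neg, one_pow, one_mul]
    have hRpos : 0 < κ * (∏ w, (-C w)) * (Fintype.card ({w : InfinitePlace L // IsComplex w} → Bool) : ℝ) :=
      mul_pos (mul_pos hκ (Finset.prod_pos fun w _ => neg_pos.2 (hCneg w))) (Nat.cast_pos.2 Fintype.card_pos)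
    set S : ℂ := ∏ w : {w : InfinitePlace L // IsComplex w}, ((SignType.sign ((w.1.embedding (α' 0 * α' 2)).re) : ℤ) : ℂ) with hSdef
    have hS : S * S = 1 := by
      rw [hSdef, ← Finset.prod_mul_distrib]
      refine Finset.prod_eq_one fun w _ => ?_
      have hre : (w.1.embedding (α' 0 * α' 2)).re ≠ 0 := by
        intro h0
        have him : (w.1.embedding (α' 0 * α' 2)).im = 0 := by
          rw [map_mul, Complex.mul_im, UnitaryGroup.im_embedding_eq_zero_of_complexConj_eq L w (hαherm 0), UnitaryGroup.im_embedding_eq_zero_of_complexConj_eq L w (hαherm 2),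
            mul_zero, zero_mul, add_zero]
        exact mul_ne_zero (hα' 0) (hα' 2) ((map_eq_zero w.1.embedding).1 (Complex.ext h0 him))
      rcases lt_or_gt_of_ne hre with h | h
      · rw [sign_neg h]; push_cast; norm_num
      · rw [sign_pos h]; push_cast; norm_num
    set D : ℂ := Tinf.Δ (Ψq.symm (UnitaryGroup.archDiagTorus L 2 ![(2 : L)⁻¹, -(2 : L)⁻¹] fun w => ![zc w, zc w]), δpt)
      (Φ (UnitaryGroup.archDiagTorus L 3 α' fun w => ![zc w, δc w, zc w])) with hDdef
    have hlaw' : lam = (s₁ : ℂ) * S * D := hlaw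
    have hD : D ≠ 0 := by intro h0; apply hlam; rw [hlaw', h0, mul_zero]
    have hcD : (starRingEnd ℂ) D ≠ 0 := fun h => hD (by simpa using congrArg (starRingEnd ℂ) h)
    have hs₁0 : (s₁ : ℂ) ≠ 0 := Complex.ofReal_ne_zero.2 hs₁.ne'
    refine ⟨P, α', hPα, h₁, h₂, Φ (UnitaryGroup.archDiagTorus L 3 α' fun w => ![zc w, δc w, zc w]),
      κ * (∏ w, (-C w)) * (Fintype.card ({w : InfinitePlace L // IsComplex w} → Bool) : ℝ) / (s₁ * Complex.normSq D), hΦ _, hst,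
      div_pos hRpos (mul_pos hs₁ (Complex.normSq_pos.2 hD)), ?_⟩
    show ((κ * (∏ w, C w) * (Fintype.card ({w : InfinitePlace L // IsComplex w} → Bool) : ℝ) : ℝ) : ℂ) / lam =
      (-1) ^ Fintype.card {w : InfinitePlace L // IsComplex w} * S * ((κ * (∏ w, (-C w)) * (Fintype.card ({w : InfinitePlace L // IsComplex w} → Bool) : ℝ) / (s₁ * Complex.normSq D) : ℝ) : ℂ) * (starRingEnd ℂ) D
    rw [div_eq_iff hlam, hlaw', hprod]; push_cast; rw [← Complex.mul_conj]; field_simp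
    linear_combination (-(∏ w, (-(C w : ℂ)))) * hS
  intro aH a ha haH hδT
  have haHm : Measurable aH := haH.continuous.measurable; have ham : Measurable a := ha.continuous.measurable
  have haΦ : ArchSmooth L 3 (Matrix.diagonal α') (a ∘ Φ) := ha.comp_archCongr L _ Φ hΦ
  obtain ⟨Θ₂, hΘ, hΘc, hΘa⟩ := haH.exists_contDiff_twoBlock
    (Matrix.GeneralLinearGroup.map (mixedEmbedding L) (Matrix.GeneralLinearGroup.mkOfDetNeZero !![(1 : L), 1; 1, -1] (UnitaryGroup.det_quasiSplitFrameTwo_ne_zero L))) Ψq hΨq δpt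
  have hγ2' : (((γH.2 : unitaryGroup (cmConjRingHom L) (Matrix.of fun i j : Fin 1 => if i.val + j.val + 1 = 1 then (1 : L) else 0)).val : GL (Fin 1) L) :
      Matrix (Fin 1) (Fin 1) L) = e₂ • (1 : Matrix (Fin 1) (Fin 1) L) := by
    ext i j; fin_cases i; fin_cases j
    rw [Matrix.smul_apply, Matrix.one_apply_eq, smul_eq_mul, mul_one]; exact hγ2
  have hcen₂ : cmRationalToArch L 1 (Matrix.of fun i j : Fin 1 => if i.val + j.val + 1 = 1 then (1 : L) else 0) γH.2 = δpt := by
    rw [cmRationalToArch_one_eq_symm_circleDiagonal_of_coe_eq_smul_one γH.2 hγ2', hδpt]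
  have hcen₁ : Ψq (cmRationalToArch L 2 (Matrix.of fun i j : Fin 2 => if i.val + j.val + 1 = 2 then (1 : L) else 0) γH.1) =
      UnitaryGroup.archDiagTorus L 2 ![(2 : L)⁻¹, -(2 : L)⁻¹] (fun w _ => zc w) :=
    congr_cmRationalToArch_two_eq_archDiagTorus_of_coe_eq_smul_one
      (Matrix.GeneralLinearGroup.map (mixedEmbedding L) (Matrix.GeneralLinearGroup.mkOfDetNeZero !![(1 : L), 1; 1, -1] (UnitaryGroup.det_quasiSplitFrameTwo_ne_zero L))) Ψq hΨq γH.1 hγ1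
      (fun w => UnitaryGroup.norm_embedding_eq_one_of_complexConj_mul_self L e₁ h₁ w)
  have hval : aH (cmRationalToArch L 2 (Matrix.of fun i j : Fin 2 => if i.val + j.val + 1 = 2 then (1 : L) else 0) γH.1,
      cmRationalToArch L 1 (Matrix.of fun i j : Fin 1 => if i.val + j.val + 1 = 1 then (1 : L) else 0) γH.2) =
      Θ₂ ((((UnitaryGroup.archPiEquivCM 2 L (Matrix.diagonal ![(2 : L)⁻¹, -(2 : L)⁻¹])).symm (fun w : {w : InfinitePlace L // IsComplex w} =>
        (⟨UnitaryGroup.circleDiagonal 2 ![zc w, zc w], UnitaryGroup.circleDiagonal_mem_archLocal_diagonal L 2 ![(2 : L)⁻¹, -(2 : L)⁻¹] w _⟩ :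
          UnitaryGroup.archLocal L 2 (Matrix.diagonal ![(2 : L)⁻¹, -(2 : L)⁻¹]) w)) :
          UnitaryGroup.arch (↥(maximalRealSubfield L)) L (IsCMField.complexConj L) 2 (Matrix.diagonal ![(2 : L)⁻¹, -(2 : L)⁻¹])) : GL (Fin 2) (mixedSpace L)) : Matrix (Fin 2) (Fin 2) (mixedSpace L)) := by
    rw [hΘa, hcen₂]
    congr 2
    apply Ψq.injective
    rw [ContinuousMulEquiv.apply_symm_apply, hcen₁, UnitaryGroup.archDiagTorus_eq_symm_apply]
    congr 1; funext w; apply Subtype.ext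
    show UnitaryGroup.circleDiagonal 2 _ = UnitaryGroup.circleDiagonal 2 _
    congr 1; funext i; fin_cases i <;> rfl
  rw [hval]
  set B := 𝒢.family (a ∘ Φ) haΦ with hBdef
  have hBreg := 𝒢.reg (a ∘ Φ) haΦ
  have hBstep := 𝒢.step (a ∘ Φ) haΦ
  have hBend : ∀ u : {w : InfinitePlace L // IsComplex w} → Fin 2 → Circle, B Finset.univ u = lam *
      archStableOrbitalIntegral L 3 (Matrix.diagonal α') (Literature.NumberTheory.Weil1964.UnitaryArchTopForm.archSingularTopFormFamily L (Matrix.diagonal α') (νGi.map Φ.symm)) (a ∘ Φ)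
        (UnitaryGroup.archDiagTorus L 3 α' fun w => ![zc w, δc w, zc w]) := fun u => 𝒢.end_eq (a ∘ Φ) haΦ u
  obtain ⟨I, hI⟩ : ∃ I : Finset {w : InfinitePlace L // IsComplex w} → ({w : InfinitePlace L // IsComplex w} → Fin 2 → Circle) → ℂ, I = fun T u =>
      ∑ ε : {w : InfinitePlace L // IsComplex w} → Bool,
        ∫ o, Θ₂ (((((UnitaryGroup.archPiEquivCM 2 L (Matrix.diagonal ![(2 : L)⁻¹, -(2 : L)⁻¹])).symm o) :
            UnitaryGroup.arch (↥(maximalRealSubfield L)) L (IsCMField.complexConj L) 2 (Matrix.diagonal ![(2 : L)⁻¹, -(2 : L)⁻¹])) : GL (Fin 2) (mixedSpace L)) :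
            Matrix (Fin 2) (Fin 2) (mixedSpace L))
          ∂(Measure.pi (fun w : {w : InfinitePlace L // IsComplex w} =>
            if w ∈ T then (νw w).map (fun g : UnitaryGroup.archLocal L 2 (Matrix.diagonal ![(2 : L)⁻¹, -(2 : L)⁻¹]) w =>
              g * ⟨UnitaryGroup.circleDiagonal 2 (if ε w then u w ∘ ⇑(Equiv.swap (0 : Fin 2) 1) else u w),
                UnitaryGroup.circleDiagonal_mem_archLocal_diagonal L 2 ![(2 : L)⁻¹, -(2 : L)⁻¹] w _⟩ * g⁻¹)
            else Measure.dirac (⟨UnitaryGroup.circleDiagonal 2 ![zc w, zc w], UnitaryGroup.circleDiagonal_mem_archLocal_diagonal L 2 ![(2 : L)⁻¹, -(2 : L)⁻¹] w _⟩ :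
              UnitaryGroup.archLocal L 2 (Matrix.diagonal ![(2 : L)⁻¹, -(2 : L)⁻¹]) w))) := ⟨_, rfl⟩
  obtain ⟨A, hA⟩ : ∃ A : Finset {w : InfinitePlace L // IsComplex w} → ({w : InfinitePlace L // IsComplex w} → Fin 2 → Circle) → ℂ,
      A = fun S u => ((κ * ∏ w ∈ S, C w : ℝ) : ℂ) * I (Finset.univ \ S) u := ⟨_, rfl⟩
  have hAstep : ∀ (S : Finset {w : InfinitePlace L // IsComplex w}) (w : {w : InfinitePlace L // IsComplex w}), w ∉ S →
      ∀ u : {w : InfinitePlace L // IsComplex w} → Fin 2 → Circle, (∀ v, v ∉ S → v ≠ w → u v 0 ≠ u v 1 ∧ u v 0 ≠ δc v ∧ u v 1 ≠ δc v) →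
      Tendsto (fun ψ : ℝ => deriv (fun ψ : ℝ => (2 * Real.sin ψ) • A S (Function.update u w ![zc w * Circle.exp ψ, zc w * Circle.exp (-ψ)])) ψ)
        (𝓝[>] 0) (𝓝 (A (insert w S) u)) := by
    intro S w hw u hu
    have hwT : w ∈ Finset.univ \ S := Finset.mem_sdiff.2 ⟨Finset.mem_univ w, hw⟩
    have hu' : ∀ v ∈ Finset.univ \ S, v ≠ w → u v 0 ≠ u v 1 := fun v hv hvw => (hu v (Finset.mem_sdiff.1 hv).2 hvw).1
    have h1 := (hCstep w Θ₂ hΘ hΘc (Finset.univ \ S) hwT u hu').mono_left (nhdsWithin_mono (0 : ℝ) (show Set.Ioi (0 : ℝ) ⊆ {0}ᶜ from fun x hx => ne_of_gt hx))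
    have h3 := h1.const_mul ((κ * ∏ v ∈ S, C v : ℝ) : ℂ)
    rw [hA]
    simp only [hI, deriv_two_sin_smul_const_mul]
    rw [Finset.sdiff_insert]
    convert h3 using 2
    rw [Complex.real_smul, ← mul_assoc]
    congr 1
    push_cast
    rw [Finset.prod_insert hw]
    ring
  have hregA : ∀ u : {w : InfinitePlace L // IsComplex w} → Fin 2 → Circle, (∀ v, u v 0 ≠ u v 1 ∧ u v 0 ≠ δc v ∧ u v 1 ≠ δc v) → A ∅ u = B ∅ u := by
    intro u hu
    obtain ⟨hGreg, hZ'⟩ := hpt u hu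
    have hβ := hβ₀ aH a haHm ham hδT u (fun w => (hu w).1) δpt hGreg hZ'
    rw [finsum_delta_mul_integral_comp_conj_eq_comap L (Matrix.GeneralLinearGroup.map (mixedEmbedding L) P) Φ hΦ Tinf νGi a _] at hβ
    have hB0 : B ∅ u = ∑ᶠ c'' : ConjClasses (UnitaryGroup.arch (↥(maximalRealSubfield L)) L (IsCMField.complexConj L) 3 (Matrix.diagonal α')),
        (Tinf.comap Φ.toMulEquiv (isArchNormPair_of_archCongr L _ Φ hΦ) : ArchTransferFactor L (Matrix.diagonal α')).Δ
            (Ψq.symm (UnitaryGroup.archDiagTorus L 2 ![(2 : L)⁻¹, -(2 : L)⁻¹] u), δpt) (Quotient.out c'') *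
          ∫ g, (a ∘ Φ) (g * Quotient.out c'' * g⁻¹) ∂(νGi.map Φ.symm) := hBreg u hu
    rw [← hB0] at hβ
    rw [hA]
    simp only [hI, hΘa, Finset.prod_empty, mul_one, Finset.sdiff_empty]
    rw [hβ, ← mul_assoc, ← Complex.ofReal_mul, mul_inv_cancel₀ hκ.ne', Complex.ofReal_one, one_mul]
  have hmain := joint_induction (Z := fun _ : {w : InfinitePlace L // IsComplex w} => Fin 2 → Circle) (F := ℂ)
    (fun v uv => uv 0 ≠ uv 1 ∧ uv 0 ≠ δc v ∧ uv 1 ≠ δc v) A B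
    (fun w ψ => ![zc w * Circle.exp ψ, zc w * Circle.exp (-ψ)]) (fun ψ x => (2 * Real.sin ψ) • x) (𝓝[>] (0 : ℝ))
    (fun w => eventually_nhdsGT_regular_centralCurve (zc w) (δc w) (hzδ w)) hregA hAstep
    (fun S w hw u hu => hBstep S w hw u hu)
  have hfin := hmain u₁
  rw [hA] at hfin
  simp only [hI] at hfin
  rw [Finset.sdiff_self, UnitaryGroup.sum_integral_pi_empty_eq_card_smul_apply_center L ![(2 : L)⁻¹, -(2 : L)⁻¹] νw zc Θ₂ u₁, hBend u₁] at hfin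
  have hT1 : archStableOrbitalIntegral L 3 H' (Literature.NumberTheory.Weil1964.UnitaryArchTopForm.archSingularTopFormFamily L H' νGi) a (cmRationalToArch L 3 H' γ₀) =
      archStableOrbitalIntegral L 3 (Matrix.diagonal α') (Literature.NumberTheory.Weil1964.UnitaryArchTopForm.archSingularTopFormFamily L (Matrix.diagonal α') (νGi.map Φ.symm)) (a ∘ Φ)
        (UnitaryGroup.archDiagTorus L 3 α' fun w => ![zc w, δc w, zc w]) :=
    hTr α' P hPα Φ hΦ (νGi.map Φ.symm) rfl a _ _ hwall fun x' hx' =>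
      exists_isSingularArchFrame_of_isStablyConj_cmRationalToArch L H' hherm hanis γ₀
        (not_isRegularElt_of_charpoly_eq_sq_mul _ e₁ e₂ hchar) (fun ζ h => hnsc ⟨ζ, h⟩) hx'
  rw [hT1]
  rw [Complex.real_smul] at hfin
  push_cast at hfin ⊢
  rw [div_mul_eq_mul_div, eq_div_iff hlam]
  linear_combination (-1 : ℂ) * hfin

end Frame

end Summit.HodgeConjecture.HodgeConjecture.Cruxes.H413.K2E4ExplicitArchSingularTransferOfPackagesSigned

end
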